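import Mathlib

/-!
# `Balaban1983to89.B13MayerDecoupling` — the three EXACT expansion identities of T. Bałaban, *Renormalization group
approach to lattice gauge field theories. II. Cluster expansions*, Commun. Math. Phys. **116**, 1–22 (1988),
doi:10.1007/bf01239022 [Balaban1988RG2Cluster] (cell paper B13; PDF held `paper:balaban1988-cmp116-rg-ii-cluster`,
journal page = PDF page): the decoupling expansion (1.9)/(1.10) p. 4, the Mayer expansion (2.1) p. 12, the
decomposition (2.3) p. 12 of the characteristic functions; and the PRINTED (connected-graph / Ursell) form of the
exponentiation formula (2.12)–(2.13) p. 14 as definitions.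

HONEST FRAMING (cell `lit-balaban`, verbatim): statement-level skeleton of published theorems with citation tags;
proofs where landed; nothing here is a claim about the Yang–Mills mass gap.

CITATION HEADER (lean-in-tree rule 2026-08-18; quotations read from the page renders
`run/shared/lean/pub/pub-balaban/b2b-balaban-ref1/pages/1988-cmp116-rg-II-cluster/1988-cmp116-rg-II-cluster-p004-x2.png`,
`…-p012-x2.png`, `…-p014-x2.png`).
* p. 4: *"To simplify the formulas let us omit the symbols 𝐔, 𝐉. Now, as in cluster expansions, we apply the
  fundamental theorem of calculus*
  `E(□₀, (tζ̃_□ + t_□ζ_□)H_k(B′)) = Σ_{σ⊂σ₀} Π_{Δ∈σ} ∫₀¹ ds(Δ) ∂/∂s(Δ) E(□₀, (tζ̃_□ + t_□ζ_□)H_k(H(s), G̃(s), H₀(s)B′))|_{s(σᶜ)=0}.` (1.9)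
  … *If there are other components, then the derivatives with respect to s restricted to these components render the
  term equal to 0. This simplifies the sum in (1.9). We can write it as a sum over connected domains Y₀ containing □̃⁴,
  with parameters s = 0 on Y₀ᶜ."* (1.10).
* p. 12: *"The first step is the Mayer expansion of the action density*
  `∫dμ_{C^{(k)}}(B) χ_k exp[Σ_{Y∈𝐃_k} 𝐕_k(Y, B)]
     = Σ_{𝐃⊂𝐃_k} Π_{Y∈𝐃} ∫₀¹ dt(Y) ∫dμ_{C^{(k)}}(B) χ_k exp[Σ_{Y∈𝐃} t(Y)𝐕_k(Y, B)] Π_{Y∈𝐃} 𝐕_k(Y, B).`" (2.1)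
* p. 12: *"Next, for a fixed domain Y₀ we define the set of bonds Y₀^{c*} = {b ∈ T^{(k)} : b ⊂ Y₀ᶜ}∖{b₀(c) : c ∈
  T^{(k+1)}}, and we take the following decomposition of the characteristic functions χ_k:*
  `χ_k = χ_{k,Y₀} χ_{k,Y₀ᶜ} = Σ_{P⊂Y₀^{c*}} (−1)^{|P|} χ_{k,Y₀} χᶜ_{k,P},   χᶜ_{k,P} = Π_{b∈P} χ({|B(b)| ≧ ε₁/g_k}).` (2.3)
  *Here the symbol |P| means the number of bonds in the set P."*
* p. 14: *"If the activities H(Z) of the above polymer expansion are sufficiently small, then the polymer expansion can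
  be exponentiated according to the well-known formula, see [36, 60, 26, 25, 67, 50]. We obtain by (I.2.13), (1.41),
  (2.11)* `𝐄^{(k+1)} = Σ_{n=1}^∞ (1/n!) Σ_{(Z₁,…,Z_n)} ρ^T(Z₁,…,Z_n) H(Z₁)⋯H(Z_n),` (2.12) *where ρ^T(Z) = 1, and*
  `ρ^T(Z₁,…,Z_n) = Σ_{g∈C_n} Π_{{i,j}∈g} (ζ(Z_i, Z_j) − 1),` *C_n is the set of connected graphs on the set {1,…,n}. The
  representation (I.1.7) for 𝐄^{(k+1)} is constructed by taking*
  `𝐄^{(k+1)}(X) = Σ_{n=1}^∞ (1/n!) Σ_{(Z₁,…,Z_n): ∪Z_i = X} ρ^T(Z₁,…,Z_n) H(Z₁)⋯H(Z_n),` (2.13) *where X ∈ 𝐃_{k+1}."*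
  ([26] of [Balaban1987RG1]'s list = [Cammarota1982], whose (1.17) p. 519 defines the same *"combinatorial function φ^T
  (truncated function) … where C_n is the set of the connected graphs on {1,…,n}"*.)

WHAT IS REPRODUCED (unit `lit-balaban-r10`, reader/typer of CMP 116 for the mega-formalization cell `lit-balaban`;
SKELETON rows B13-E1.9, B13-E1.10, B13-E2.1, B13-E2.3, B13-D2.12, B13-D2.13 of `run/shared/lean/pub/lit-balaban/
lit-balaban-r10/SKELETON-B13.md`).  Nothing else of the paper: the 35 sibling modules `…Balaban1983to89.B13*`
(cell `pub-balaban`) already type Lemmas 1–3, the constants, the closing chain and certify most located steps; this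
module adds only the pieces that were absent there.
* Part A — (1.9) AS AN EXACT IDENTITY VALID FOR EVERY FUNCTION of finitely many parameters.  By the one-variable
  fundamental theorem of calculus each factor `∫₀¹ ds(Δ) ∂/∂s(Δ)` of (1.9) is the difference operator
  `δ_Δ G (s) = G(s|_{s(Δ)=1}) − G(s|_{s(Δ)=0})` (`delta`; the dictionary with the printed integral is
  `integral_deriv_eq_delta`), so the σ-term of (1.9) is the iterated difference `D_σ E` (`Dop`, `Dop_insert`) evaluated at
  `s(σ₀∖σ) = 0`, and (1.9) is the hypothesis-free identity `Σ_{σ⊆σ₀} (D_σ E)(s|_{σ₀}=0) = E(s|_{σ₀}=1)` (`decoupling_19`,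
  proved by induction on σ₀).  The mechanism of (1.10) — a term whose function does not depend on some `s(Δ)`, `Δ ∈ σ`,
  vanishes — is `Dop_eq_zero_of_indep`.
* Part B — (2.1) pointwise in `B` (the Gaussian integral `∫dμ_{C^{(k)}}(B)χ_k …` is linear and is applied to both sides;
  the fields are schematic in the tree, cf. `B13.StepData`): `exp(Σ_{Y∈𝒟} V_Y) = Σ_{𝐃⊆𝒟} Π_{Y∈𝐃}(e^{V_Y} − 1)`
  (`exp_sum_eq_sum_powerset_prod`) and `e^{v} − 1 = ∫₀¹ dt e^{tv} v` (`integral_exp_mul_eq`), whence the printed form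
  `exp(Σ_{Y∈𝒟} V_Y) = Σ_{𝐃⊆𝒟} Π_{Y∈𝐃} ∫₀¹ dt(Y) e^{t(Y)V_Y} V_Y` (`mayer_expansion_21`).
* Part C — (2.3): `Π_{b∈S} χ(|B(b)| < r) = Σ_{P⊆S} (−1)^{|P|} Π_{b∈P} χ(|B(b)| ≥ r)` (`charFn_decomposition_23`, from the
  ring identity `prod_one_sub_eq_sum_powerset`).
* Part D — DEFINITIONS ONLY (no convergence asserted): the set `C_n` of connected graphs on `{1,…,n}` as sets of
  ordered pairs `i < j` (`connGraphs`), the printed Ursell coefficient `ρ^T` (`rhoT`, with `rhoT_one` : ρ^T(Z) = 1 and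
  `rhoT_zero` : the empty sequence contributes nothing, so the series start at n = 1 as printed), and the printed series
  (2.12), (2.13) over a finite polymer catalogue (`ursellSeries212`, `ursellSeries213`, as `tsum`s in `n`).  The tree's
  KERNEL route to (2.12)/(2.13) is the Kotecký–Preiss form `Literature.Probability.LatticeModels.polymerLogZ_eq_sum_
  truncatedWeight` / `…Balaban1983to89.B13Resummation.locE` (unit b2b-balaban-pv18); the classical Mayer identity
  equating the two forms term by term ([Cammarota1982] Thm 1 / (1.17)) is NOT proved here (SKELETON row B13-D2.12,
  Phase 2 candidate).
* Part E — p. 18: the cube count *"|P| ≧ ½M⁻⁴|Z₀∖Y₀|, because one bond in P may connect two cubes"*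
  (`card_le_two_mul_card_of_cover`) and the P-sum (2.31) with its five-fifths bookkeeping made explicit
  (`sum_P_bound_231`, `bound_231_le_one`) — real arithmetic, second engine for the cell transcript's hand certification
  (SKELETON rows B13-E2.31, B13-G7); the sibling `B13.lean` Part E certifies (2.22), (2.28), (2.33), (2.34) the same way.
* Part F (v3, append-only) — (1.9) WITH THE PRINTED INTEGRALS: the operator `Π_{Δ∈l} ∫₀¹ ds(Δ) ∂/∂s(Δ)` (`Top`, the
  mixed partials supplied as a family `Fam`, regularity `HasLinePartials` = derivatives along every parameter axis to
  all orders, which the paper's analytic-in-s functions have) EQUALS the iterated difference `D_σ` for every enumeration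
  `l` of `σ` (`Top_eq_Dop`: one fundamental theorem of calculus per cube; order-independence for free), hence the display
  (1.9) verbatim: `Σ_{σ⊆σ₀} (Π_{Δ∈σ}∫₀¹ds(Δ)∂/∂s(Δ)) E|_{s(σ₀∖σ)=0} = E|_{s(σ₀)=1}` (`decoupling_19_integral`).

* Part G (v6, append-only; unit `lit-balaban-r10` gen 3, SKELETON rows `B13.Def§1@4` (case 2) and `B13.Eq1.10`) —
  **(1.10) p. 4 itself, with the printed notion of connectedness.**  P. 4, verbatim: *"Consider a term in the last sum.
  The set Y(σ) = □̃⁴ ∪ (∪_{Δ∈σ}Δ) is a sum of connected components, with the following notion of connectedness. … In the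
  second case Y is connected if and only if for any cube Δ ⊂ Y there exists a sequence having the above property
  [boundaries of two successive terms have a common d − 1-dimensional wall] and connecting Δ with □̃⁴, i.e. the last term
  in the sequence intersects □̃⁴ along a d − 1-dimensional wall. We denote by Y₀ the connected component of the domain
  Y(σ) containing the cube □̃⁴. … As a consequence of these properties we obtain that the term in the sum on the
  right-hand side of (1.9), corresponding to the set σ, depends on propagators and function B, s restricted to the
  component Y₀ … If there are other components, then the derivatives with respect to s restricted to these components
  render the term equal to 0. This simplifies the sum in (1.9). We can write it as a sum over connected domains Y₀
  containing □̃⁴, with parameters s = 0 on Y₀ᶜ. We denote s by s(Y₀), hence we have*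
  `E(□₀,(tζ̃_□+t_□ζ_□)H_k(B′)) = Σ_{Y₀} Π_{Δ⊂Y₀∖□̃⁴} ∫₀¹ ds(Δ) ∂/∂s(Δ) E(□₀,(tζ̃_□+t_□ζ_□)H_k(H(s(Y₀)),G̃(s(Y₀)),(H₀B′)(s(Y₀))))` (1.10)".
  Typed over an abstract wall-adjacency `W` on the σ₀-cubes and the predicate `B` = "meets □̃⁴ along a (d−1)-dimensional
  wall": `Linked W σ` (chains inside σ), `compY0 W B σ` (the cubes of the component Y₀ of Y(σ) = □̃⁴ ∪ ⋃σ), `RelConnected`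
  (case 2 of the definition: Y(σ) is connected); PROVED: `relConnected_iff_compY0_eq`, `relConnected_compY0` (Y₀ IS
  connected), `Dop_eq_zero_of_indep_at` (the vanishing mechanism LOCALIZED to the evaluation points `s(σᶜ) = 0`, which is
  all the p. 4 claim provides), and **`decoupling_110` / `decoupling_110_integral`** = the display (1.10): given the p. 4
  SUPPORT CLAIM as the explicit hypothesis (at parameter points vanishing on σ₀∖σ the term does not depend on s(Δ) for
  the cubes Δ of σ outside Y₀ — by assertion in print, an operator-locality fact about H(s), G̃(s), H₀(s), (1.3), (1.4)),
  the sum (1.9) EQUALS the sum over the σ with Y(σ) connected, i.e. over the connected domains Y₀ ∋ □̃⁴ with s = s(Y₀).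

WHAT IS *NOT* ASSERTED.  Nothing of the series; the regularity of the paper's actual functions of `s` (analytic through
fixed points and random-walk expansions — `B13Contraction113`, `B13WalkCubes111`) enters `decoupling_19_integral` as the
hypothesis `HasLinePartials`; no convergence of (2.12)/(2.13) (that is Lemma 3 + [26], typed in `B13.lean` as
`Lemma3Printed`, `CammarotaStep`).  All statements below are [folklore] calculus/combinatorics instantiated at the
printed formulas, tagged with the display they transcribe.
-/

noncomputable section

namespace Literature.MathematicalPhysics.QuantumFieldTheory.Balaban1983to89.B13MayerDecoupling

open Finset

/-! ## Part A. (1.9)/(1.10) p. 4 — the decoupling expansion as an exact identity -/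

section Decoupling

variable {ι : Type*} [DecidableEq ι] {E : Type*} [AddCommGroup E]

/-- The parameter point obtained from `s` by setting, on the cubes `Δ ∈ σ`, `s(Δ) = 1` if `Δ ∈ τ` and `s(Δ) = 0`
otherwise (the corners of the cube `[0,1]^σ` at which the σ-term of (1.9) is evaluated; outside `σ` the point `s` is
untouched — in (1.9) it is then set to `0` on `σ₀∖σ`: *"|_{s(σᶜ)=0}"*).
  Existing carrier citing the same locus (1.9)–(1.10): the parameter DEVICE
`B13GaugeDevices.Inv.paramOp` (§C there: invariance survives any operation acting on the parameters `s` alone);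
this file supplies the parameter cube and the decoupling identity themselves — printed form, no duplicate.
[cite: Balaban1988RG2Cluster, (1.9) p.4] -/
def corner (σ τ : Finset ι) (s : ι → ℝ) : ι → ℝ :=
  fun i => if i ∈ σ then (if i ∈ τ then 1 else 0) else s i

/-- The difference operator in the parameter `s(Δ)`: `δ_Δ G (s) = G(s|_{s(Δ)=1}) − G(s|_{s(Δ)=0})` — by the
fundamental theorem of calculus this is the factor `∫₀¹ ds(Δ) ∂/∂s(Δ)` of (1.9) (`integral_deriv_eq_delta`).
(Existing device-form carrier of the locus: `B13GaugeDevices.Inv.paramOp`, see `corner`.)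
[cite: Balaban1988RG2Cluster, (1.9) p.4] -/
def delta (Δ : ι) (G : (ι → ℝ) → E) : (ι → ℝ) → E :=
  fun s => G (Function.update s Δ 1) - G (Function.update s Δ 0)

/-- The σ-term of (1.9) before the evaluation `s(σᶜ) = 0`: the iterated difference
`D_σ G (s) = Σ_{τ⊆σ} (−1)^{|σ∖τ|} G(corner σ τ s) = (Π_{Δ∈σ} δ_Δ) G (s)` (`Dop_insert`).
(Existing device-form carrier of the locus: `B13GaugeDevices.Inv.paramOp`, see `corner`.)
[cite: Balaban1988RG2Cluster, (1.9) p.4] -/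
def Dop (σ : Finset ι) (G : (ι → ℝ) → E) : (ι → ℝ) → E :=
  fun s => ∑ τ ∈ σ.powerset, ((-1 : ℤ) ^ (σ \ τ).card) • G (corner σ τ s)

/-- `corner ∅ ∅ s = s` (plumbing). [cite: Balaban1988RG2Cluster, (1.9) p.4] (elementary API for (1.9)) -/
private theorem corner_empty (s : ι → ℝ) : corner (∅ : Finset ι) ∅ s = s := by
  funext i; simp [corner]

/-- Updating a coordinate outside `σ` commutes with `corner σ τ` (plumbing).
[cite: Balaban1988RG2Cluster, (1.9) p.4] (elementary API for (1.9)) -/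
private theorem corner_update {σ τ : Finset ι} {Δ : ι} (hΔ : Δ ∉ σ) (s : ι → ℝ) (a : ℝ) :
    corner σ τ (Function.update s Δ a) = Function.update (corner σ τ s) Δ a := by
  funext i
  by_cases hi : i = Δ
  · subst hi; simp [corner, hΔ]
  · simp [corner, Function.update, hi]

/-- The corners of `[0,1]^{insert Δ σ}` with `s(Δ) = 1` (plumbing).
[cite: Balaban1988RG2Cluster, (1.9) p.4] (elementary API for (1.9)) -/
private theorem corner_insert_insert {σ τ : Finset ι} {Δ : ι} (hΔ : Δ ∉ σ) (s : ι → ℝ) :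
    corner (insert Δ σ) (insert Δ τ) s = Function.update (corner σ τ s) Δ 1 := by
  funext i
  by_cases hi : i = Δ
  · subst hi; simp [corner]
  · simp [corner, Function.update, hi]

/-- The corners of `[0,1]^{insert Δ σ}` with `s(Δ) = 0`, `Δ ∉ τ` (plumbing).
[cite: Balaban1988RG2Cluster, (1.9) p.4] (elementary API for (1.9)) -/
private theorem corner_insert_of_not_mem {σ τ : Finset ι} {Δ : ι} (hΔ : Δ ∉ σ) (hτ : Δ ∉ τ) (s : ι → ℝ) :
    corner (insert Δ σ) τ s = Function.update (corner σ τ s) Δ 0 := by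
  funext i
  by_cases hi : i = Δ
  · subst hi; simp [corner, hτ]
  · simp [corner, Function.update, hi]

/-- `D_∅ = id`: the term σ = ∅ of (1.9) is the function itself (evaluated at `s(σ₀) = 0`).
[cite: Balaban1988RG2Cluster, (1.9) p.4] -/
theorem Dop_empty (G : (ι → ℝ) → E) : Dop (∅ : Finset ι) G = G := by
  funext s
  simp [Dop, corner_empty]

/-- The product structure `Π_{Δ∈σ}` of (1.9): `D_{insert Δ σ} = δ_Δ ∘ D_σ` for `Δ ∉ σ`.
[cite: Balaban1988RG2Cluster, (1.9) p.4] -/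
theorem Dop_insert {σ : Finset ι} {Δ : ι} (hΔ : Δ ∉ σ) (G : (ι → ℝ) → E) :
    Dop (insert Δ σ) G = delta Δ (Dop σ G) := by
  funext s
  simp only [Dop, delta]
  rw [Finset.sum_powerset_insert hΔ]
  have h1 : ∀ τ ∈ σ.powerset,
      ((-1 : ℤ) ^ (insert Δ σ \ τ).card) • G (corner (insert Δ σ) τ s)
        = -(((-1 : ℤ) ^ (σ \ τ).card) • G (corner σ τ (Function.update s Δ 0))) := by
    intro τ hτ
    have hτσ : τ ⊆ σ := Finset.mem_powerset.1 hτ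
    have hΔτ : Δ ∉ τ := fun h => hΔ (hτσ h)
    have hcard : (insert Δ σ \ τ).card = (σ \ τ).card + 1 := by
      rw [Finset.insert_sdiff_of_notMem _ hΔτ, Finset.card_insert_of_notMem]
      exact fun h => hΔ (Finset.mem_sdiff.1 h).1
    rw [hcard, pow_succ, corner_insert_of_not_mem hΔ hΔτ, corner_update hΔ, mul_neg_one, neg_smul]
  have h2 : ∀ τ ∈ σ.powerset,
      ((-1 : ℤ) ^ (insert Δ σ \ insert Δ τ).card) • G (corner (insert Δ σ) (insert Δ τ) s)
        = ((-1 : ℤ) ^ (σ \ τ).card) • G (corner σ τ (Function.update s Δ 1)) := by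
    intro τ hτ
    have hτσ : τ ⊆ σ := Finset.mem_powerset.1 hτ
    have hΔτ : Δ ∉ τ := fun h => hΔ (hτσ h)
    have hsd : insert Δ σ \ insert Δ τ = σ \ τ := by
      ext i
      simp only [Finset.mem_sdiff, Finset.mem_insert]
      constructor
      · rintro ⟨h1 | h1, h2⟩
        · exact absurd (Or.inl h1) h2
        · exact ⟨h1, fun h => h2 (Or.inr h)⟩
      · rintro ⟨h1, h2⟩
        exact ⟨Or.inr h1, fun h => h.elim (fun h' => hΔ (h' ▸ h1)) h2⟩
    rw [hsd, corner_insert_insert hΔ, corner_update hΔ]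
  rw [Finset.sum_congr rfl h1, Finset.sum_congr rfl h2, Finset.sum_neg_distrib]
  abel

/-- **(1.9) p. 4, the decoupling expansion, as an exact identity.**  For EVERY function `G` of the parameters
`s(Δ)`, `Δ ∈ σ₀` (and of anything else, carried by the coordinates of `s` outside `σ₀`):
`Σ_{σ⊆σ₀} (Π_{Δ∈σ} δ_Δ G)|_{s(σ₀∖σ)=0} = G|_{s(σ₀)=1}` — with `δ_Δ = ∫₀¹ ds(Δ) ∂/∂s(Δ)` (`integral_deriv_eq_delta`)
this is verbatim the printed *"Σ_{σ⊂σ₀} Π_{Δ∈σ} ∫₀¹ ds(Δ) ∂/∂s(Δ) E(…(s))|_{s(σᶜ)=0} = E(…)"*, the left side being the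
decoupled function at `s = 1`, where it coincides with the original one ((1.8) p. 3).  Proof: induction on σ₀, peeling
one cube with `Dop_insert`. [cite: Balaban1988RG2Cluster, (1.9) p.4] -/
theorem decoupling_19 (σ₀ : Finset ι) (G : (ι → ℝ) → E) (s : ι → ℝ) :
    ∑ σ ∈ σ₀.powerset, Dop σ G (corner σ₀ ∅ s) = G (corner σ₀ σ₀ s) := by
  induction σ₀ using Finset.induction_on generalizing s with
  | empty => simp [Dop_empty, corner_empty]
  | @insert Δ σ₀ hΔ ih =>
    rw [Finset.sum_powerset_insert hΔ]
    have hz : corner (insert Δ σ₀) ∅ s = Function.update (corner σ₀ ∅ s) Δ 0 :=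
      corner_insert_of_not_mem hΔ (Finset.notMem_empty Δ) s
    have hstep : ∀ σ ∈ σ₀.powerset, Dop (insert Δ σ) G (corner (insert Δ σ₀) ∅ s)
        = Dop σ G (corner σ₀ ∅ (Function.update s Δ 1)) - Dop σ G (corner (insert Δ σ₀) ∅ s) := by
      intro σ hσ
      have hΔσ : Δ ∉ σ := fun h => hΔ (Finset.mem_powerset.1 hσ h)
      rw [Dop_insert hΔσ]
      simp only [delta]
      rw [hz, Function.update_idem, Function.update_idem, corner_update hΔ]
    rw [Finset.sum_congr rfl hstep, Finset.sum_sub_distrib, add_sub_cancel, ih (Function.update s Δ 1),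
      corner_update hΔ, ← corner_insert_insert hΔ]

/-- **The mechanism of (1.10) p. 4**, verbatim: *"If there are other components, then the derivatives with respect to
s restricted to these components render the term equal to 0."* — if `G` does not depend on the parameter `s(Δ)` for
some `Δ ∈ σ`, the σ-term of (1.9) vanishes identically. [cite: Balaban1988RG2Cluster, (1.10) p.4] -/
theorem Dop_eq_zero_of_indep {σ : Finset ι} {Δ : ι} (hΔ : Δ ∈ σ) (G : (ι → ℝ) → E)
    (hG : ∀ s a, G (Function.update s Δ a) = G (Function.update s Δ 0)) : Dop σ G = 0 := by
  have hσ : σ = insert Δ (σ.erase Δ) := (Finset.insert_erase hΔ).symm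
  have hΔ' : Δ ∉ σ.erase Δ := Finset.notMem_erase Δ σ
  rw [hσ, Dop_insert hΔ']
  funext s
  simp only [delta, Dop, Pi.zero_apply]
  rw [← Finset.sum_sub_distrib]
  refine Finset.sum_eq_zero fun τ _ => ?_
  rw [corner_update hΔ', corner_update hΔ', hG _ 1, sub_self]

end Decoupling

section FTC

variable {ι : Type*} [DecidableEq ι] {E : Type*} [NormedAddCommGroup E] [NormedSpace ℝ E] [CompleteSpace E]

/-- The dictionary behind Part A, p. 4 verbatim *"we apply the fundamental theorem of calculus"*: if
`x ↦ G(s|_{s(Δ)=x})` has the derivative `g x` at every `x ∈ [0, 1]` and `g` is integrable there, then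
`∫₀¹ ds(Δ) ∂G/∂s(Δ) = δ_Δ G (s)`.  (Mathlib's `intervalIntegral.integral_eq_sub_of_hasDerivAt`.)
[cite: Balaban1988RG2Cluster, (1.9) p.4] -/
theorem integral_deriv_eq_delta (G : (ι → ℝ) → E) (s : ι → ℝ) (Δ : ι) (g : ℝ → E)
    (hderiv : ∀ x ∈ Set.uIcc (0 : ℝ) 1, HasDerivAt (fun y => G (Function.update s Δ y)) (g x) x)
    (hint : IntervalIntegrable g MeasureTheory.volume 0 1) :
    ∫ x in (0 : ℝ)..1, g x = delta Δ G s := by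
  rw [intervalIntegral.integral_eq_sub_of_hasDerivAt hderiv hint]
  rfl

end FTC

/-! ## Part B. (2.1) p. 12 — the Mayer expansion of the action density (pointwise in the field `B`) -/

section Mayer

variable {α : Type*}

/-- `Π_{Y∈𝒟} e^{V_Y}` expanded by `e^{V} = 1 + (e^{V} − 1)`:
`exp(Σ_{Y∈𝒟} V_Y) = Σ_{𝐃⊆𝒟} Π_{Y∈𝐃} (e^{V_Y} − 1)` — the combinatorial half of (2.1). [cite: Balaban1988RG2Cluster, (2.1) p.12] -/
theorem exp_sum_eq_sum_powerset_prod (𝒟 : Finset α) (V : α → ℂ) :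
    Complex.exp (∑ Y ∈ 𝒟, V Y) = ∑ D ∈ 𝒟.powerset, ∏ Y ∈ D, (Complex.exp (V Y) - 1) := by
  rw [Complex.exp_sum, ← Finset.prod_one_add]
  exact Finset.prod_congr rfl fun Y _ => by ring

/-- The calculus half of (2.1): `∫₀¹ dt e^{tv} v = e^{v} − 1` (the derivative of `t ↦ e^{tv}` is `e^{tv} v`).
[cite: Balaban1988RG2Cluster, (2.1) p.12] -/
theorem integral_exp_mul_eq (v : ℂ) :
    ∫ t in (0 : ℝ)..1, Complex.exp ((t : ℂ) * v) * v = Complex.exp v - 1 := by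
  have hderiv : ∀ t ∈ Set.uIcc (0 : ℝ) 1,
      HasDerivAt (fun y : ℝ => Complex.exp ((y : ℂ) * v)) (Complex.exp ((t : ℂ) * v) * v) t := by
    intro t _
    have h1 : HasDerivAt (fun y : ℝ => (y : ℂ) * v) ((1 : ℂ) * v) t :=
      (hasDerivAt_id t).ofReal_comp.mul_const v
    simpa using h1.cexp
  have hcont : Continuous fun t : ℝ => Complex.exp ((t : ℂ) * v) * v := by fun_prop
  rw [intervalIntegral.integral_eq_sub_of_hasDerivAt hderiv (hcont.intervalIntegrable 0 1)]
  simp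

/-- **(2.1) p. 12, the Mayer expansion**, pointwise in the field (the integral `∫dμ_{C^{(k)}}(B) χ_k ·` of the printed
formula is applied to both sides): for every finite family `𝒟` (= 𝐃_k) of localization domains and all values
`V_Y = 𝐕_k(Y, B)`,
`exp[Σ_{Y∈𝒟} V_Y] = Σ_{𝐃⊆𝒟} Π_{Y∈𝐃} ∫₀¹ dt(Y) exp[t(Y)V_Y] V_Y`
(and `Π_{Y∈𝐃} ∫₀¹dt(Y) e^{t(Y)V_Y}V_Y = Π∫ … exp[Σ_{Y∈𝐃} t(Y)V_Y] Π V_Y` is the printed grouping of the same product of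
one-dimensional integrals). [cite: Balaban1988RG2Cluster, (2.1) p.12] -/
theorem mayer_expansion_21 (𝒟 : Finset α) (V : α → ℂ) :
    Complex.exp (∑ Y ∈ 𝒟, V Y)
      = ∑ D ∈ 𝒟.powerset, ∏ Y ∈ D, ∫ t in (0 : ℝ)..1, Complex.exp ((t : ℂ) * V Y) * V Y := by
  rw [exp_sum_eq_sum_powerset_prod]
  refine Finset.sum_congr rfl fun D _ => Finset.prod_congr rfl fun Y _ => ?_
  rw [integral_exp_mul_eq]

end Mayer

/-! ## Part C. (2.3) p. 12 — the decomposition of the small-field characteristic functions -/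

section CharFn

variable {α : Type*}

/-- The ring identity which IS (2.3) p. 12 once `χ({|B(b)| < r}) = 1 − χ({|B(b)| ≧ r})` is substituted:
`Π_{b∈S} (1 − χ_b) = Σ_{P⊆S} (−1)^{|P|} Π_{b∈P} χ_b` for elements `χ_b` of any commutative ring.
[cite: Balaban1988RG2Cluster, (2.3) p.12] -/
theorem prod_one_sub_eq_sum_powerset {R : Type*} [CommRing R] (S : Finset α) (χ : α → R) :
    ∏ b ∈ S, (1 - χ b) = ∑ P ∈ S.powerset, (-1) ^ P.card * ∏ b ∈ P, χ b := by
  have h : ∀ b ∈ S, (1 - χ b) = 1 + (-χ b) := fun b _ => by ring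
  rw [Finset.prod_congr rfl h, Finset.prod_one_add]
  refine Finset.sum_congr rfl fun P _ => ?_
  rw [Finset.prod_neg]

/-- **(2.3) p. 12**, verbatim: *"χ_k = χ_{k,Y₀}χ_{k,Y₀ᶜ} = Σ_{P⊂Y₀^{c*}} (−1)^{|P|} χ_{k,Y₀} χᶜ_{k,P},
χᶜ_{k,P} = Π_{b∈P} χ({|B(b)| ≧ ε₁/g_k}). Here the symbol |P| means the number of bonds in the set P."* — the factor
`χ_{k,Y₀ᶜ} = Π_{b∈Y₀^{c*}} χ({|B(b)| < ε₁/g_k})` (the small-field characteristic function of [I] (2.13) restricted to the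
bonds `S = Y₀^{c*}`, threshold `r = ε₁/g_k`) expanded by `χ({|B(b)| < r}) = 1 − χ({|B(b)| ≧ r})`; the common factor
`χ_{k,Y₀}` multiplies both sides. [cite: Balaban1988RG2Cluster, (2.3) p.12] -/
theorem charFn_decomposition_23 (S : Finset α) (B : α → ℝ) (r : ℝ) :
    ∏ b ∈ S, (if |B b| < r then (1 : ℝ) else 0)
      = ∑ P ∈ S.powerset, (-1) ^ P.card * ∏ b ∈ P, (if r ≤ |B b| then (1 : ℝ) else 0) := by
  have h : ∀ b ∈ S, (if |B b| < r then (1 : ℝ) else 0) = 1 - (if r ≤ |B b| then (1 : ℝ) else 0) := by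
    intro b _
    by_cases hb : |B b| < r
    · simp [hb, not_le.2 hb]
    · simp [hb, not_lt.1 hb]
  rw [Finset.prod_congr rfl h, prod_one_sub_eq_sum_powerset]

end CharFn

/-! ## Part D. (2.12)/(2.13) p. 14 — the printed Ursell coefficient and the exponentiated series (definitions) -/

section Ursell

/-- The possible lines `{i, j}`, `i < j`, of a graph on `{1,…,n}` (print: *"Π_{{i,j}, i<j}"* in (2.11)), as ordered
pairs.  Existing carriers citing (2.11)–(2.13), all in the Kotecký–Preiss / abstract-resummation vocabulary (no graph
objects there): `B13Factor210.Hsum` ((2.9)–(2.11) first form), `B13Resummation.locE` / `kp_condition` ((2.12)–(2.13)),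
`B13Closing`, `B12StepFromB13`; the objects of this Part are the PRINTED Ursell form (DUPLICATES rule: printed form,
carriers named). [cite: Balaban1988RG2Cluster, (2.11)–(2.12) p.14] -/
def lines (n : ℕ) : Finset (Fin n × Fin n) :=
  Finset.univ.filter fun p => p.1 < p.2

/-- The simple graph on `Fin n` spanned by a set of lines.
[cite: Balaban1988RG2Cluster, (2.12) p.14] (elementary API for (2.12)) -/
def graphOf {n : ℕ} (g : Finset (Fin n × Fin n)) : SimpleGraph (Fin n) :=
  SimpleGraph.fromRel fun i j => (i, j) ∈ g

open Classical in
/-- `C_n`, verbatim p. 14: *"C_n is the set of connected graphs on the set {1,…,n}"* — the sets of lines `g ⊆ lines n`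
whose graph is connected (for `n = 0` there is none: a connected graph has a vertex). The same object is
[Cammarota1982] (1.17) p. 519.  (Existing carrier of the locus in KP form: `B13Resummation.locE`; see `lines`.)
[cite: Balaban1988RG2Cluster, (2.12) p.14] -/
def connGraphs (n : ℕ) : Finset (Finset (Fin n × Fin n)) :=
  (lines n).powerset.filter fun g => (graphOf g).Connected

/-- The Ursell coefficient of (2.12) p. 14, verbatim: *"ρ^T(Z₁,…,Z_n) = Σ_{g∈C_n} Π_{{i,j}∈g} (ζ(Z_i, Z_j) − 1)"*, for a
sequence `Z : Fin n → P` of polymers and a two-body function `ζ` (print: the hard core *"ζ(Z, Z′) = 0 if Z ∩ Z′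
contains a cube, or a wall of a cube, and ζ(Z, Z′) = 1 otherwise"*, (2.11)).  (Existing carriers of the locus in KP
form: `B13Resummation.locE` / `kp_condition`, `B13Closing`; see `lines`.) [cite: Balaban1988RG2Cluster, (2.12) p.14] -/
def rhoT {P : Type*} (ζ : P → P → ℝ) {n : ℕ} (Z : Fin n → P) : ℝ :=
  ∑ g ∈ connGraphs n, ∏ p ∈ g, (ζ (Z p.1) (Z p.2) - 1)

/-- There are no lines on one vertex (plumbing).
[cite: Balaban1988RG2Cluster, (2.12) p.14] (elementary API for (2.12)) -/
private theorem lines_one : lines 1 = ∅ := by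
  ext p
  simp only [lines, Finset.mem_filter, Finset.mem_univ, true_and, Finset.notMem_empty, iff_false, not_lt]
  exact le_of_eq (Subsingleton.elim _ _)

/-- There are no lines on no vertex (plumbing).
[cite: Balaban1988RG2Cluster, (2.12) p.14] (elementary API for (2.12)) -/
private theorem lines_zero : lines 0 = ∅ := by
  ext p; exact Fin.elim0 p.1

/-- `C_1 = {the one-vertex graph}` — the content of the printed *"ρ^T(Z) = 1"*. [cite: Balaban1988RG2Cluster, (2.12) p.14] -/
theorem connGraphs_one : connGraphs 1 = {∅} := by
  ext g
  simp only [connGraphs, lines_one, Finset.powerset_empty, Finset.filter_singleton, Finset.mem_singleton]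
  have hc : (graphOf (∅ : Finset (Fin 1 × Fin 1))).Connected := SimpleGraph.Connected.of_subsingleton
  simp [hc]

/-- `C_0 = ∅`: a connected graph has a vertex, so the series (2.12)/(2.13) have no `n = 0` term, as printed
(`Σ_{n=1}^∞`). [cite: Balaban1988RG2Cluster, (2.12) p.14] -/
theorem connGraphs_zero : connGraphs 0 = ∅ := by
  ext g
  simp only [connGraphs, lines_zero, Finset.powerset_empty, Finset.filter_singleton, Finset.notMem_empty,
    iff_false]
  have hnc : ¬ (graphOf (∅ : Finset (Fin 0 × Fin 0))).Connected := fun h => by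
    have := h.nonempty; exact (Fin.elim0 this.some)
  simp [hnc]

/-- (2.12) p. 14, verbatim: *"where ρ^T(Z) = 1"*. [cite: Balaban1988RG2Cluster, (2.12) p.14] -/
theorem rhoT_one {P : Type*} (ζ : P → P → ℝ) (Z : Fin 1 → P) : rhoT ζ Z = 1 := by
  simp [rhoT, connGraphs_one]

/-- The empty sequence has Ursell coefficient `0` (no connected graph on no vertex), so (2.12)/(2.13) start at
`n = 1` as printed. [cite: Balaban1988RG2Cluster, (2.12) p.14] -/
theorem rhoT_zero {P : Type*} (ζ : P → P → ℝ) (Z : Fin 0 → P) : rhoT ζ Z = 0 := by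
  simp [rhoT, connGraphs_zero]

variable {P Cube : Type*} [Fintype P] [DecidableEq Cube]

/-- (2.12) p. 14 AS PRINTED (a formal series in `n`, written as a `tsum`; its convergence is the content of Lemma 3 +
[26], NOT asserted): `𝐄^{(k+1)} = Σ_{n=1}^∞ (1/n!) Σ_{(Z₁,…,Z_n)} ρ^T(Z₁,…,Z_n) H(Z₁)⋯H(Z_n)` over a finite polymer
catalogue `P` (𝐃_{k+1} at finite volume, as in `B13Resummation`); the `n = 0` term vanishes by `rhoT_zero`.
[cite: Balaban1988RG2Cluster, (2.12) p.14] -/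
def ursellSeries212 (ζ : P → P → ℝ) (H : P → ℂ) : ℂ :=
  ∑' n : ℕ, ((n.factorial : ℂ)⁻¹ *
    ∑ Z : Fin n → P, ((rhoT ζ Z : ℝ) : ℂ) * ∏ i, H (Z i))

/-- (2.13) p. 14 AS PRINTED: `𝐄^{(k+1)}(X) = Σ_{n=1}^∞ (1/n!) Σ_{(Z₁,…,Z_n): ∪Z_i = X} ρ^T(Z₁,…,Z_n) H(Z₁)⋯H(Z_n)`,
`X ∈ 𝐃_{k+1}` — the sequences whose union of footprints (`cubes Z_i`, the LM-cubes of `Z_i`) is exactly `X`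
(a `tsum` in `n`; convergence NOT asserted).  The tree's kernel object for the same quantity is the Kotecký–Preiss form
`B13Resummation.locE` (sum of truncated weights over covering families); the term-by-term identification of the two
is the classical Mayer identity [Cammarota1982, Thm 1], not proved here. [cite: Balaban1988RG2Cluster, (2.13) p.14] -/
def ursellSeries213 (ζ : P → P → ℝ) (H : P → ℂ) (cubes : P → Finset Cube) (X : Finset Cube) : ℂ :=
  ∑' n : ℕ, ((n.factorial : ℂ)⁻¹ *
    ∑ Z ∈ (Finset.univ : Finset (Fin n → P)).filter
        (fun Z => (Finset.univ : Finset (Fin n)).biUnion (fun i => cubes (Z i)) = X),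
      ((rhoT ζ Z : ℝ) : ℂ) * ∏ i, H (Z i))

/-- Bookkeeping between (2.12) and (2.13) at each order `n`: the sequences are partitioned by the union `X` of their
footprints, so the order-`n` term of (2.12) is the sum over `X` of the order-`n` terms of (2.13) (print p. 14: *"The
representation (I.1.7) for 𝐄^{(k+1)} is constructed by taking"* (2.13)). [cite: Balaban1988RG2Cluster, (2.12)–(2.13) p.14] -/
theorem term212_eq_sum_term213 (ζ : P → P → ℝ) (H : P → ℂ) (cubes : P → Finset Cube) (n : ℕ)
    (𝒳 : Finset (Finset Cube))
    (h𝒳 : ∀ Z : Fin n → P, (Finset.univ : Finset (Fin n)).biUnion (fun i => cubes (Z i)) ∈ 𝒳) :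
    ∑ Z : Fin n → P, ((rhoT ζ Z : ℝ) : ℂ) * ∏ i, H (Z i)
      = ∑ X ∈ 𝒳, ∑ Z ∈ (Finset.univ : Finset (Fin n → P)).filter
          (fun Z => (Finset.univ : Finset (Fin n)).biUnion (fun i => cubes (Z i)) = X),
          ((rhoT ζ Z : ℝ) : ℂ) * ∏ i, H (Z i) := by
  classical
  rw [← Finset.sum_fiberwise_of_maps_to (s := (Finset.univ : Finset (Fin n → P))) (t := 𝒳)
    (g := fun Z => (Finset.univ : Finset (Fin n)).biUnion (fun i => cubes (Z i))) (fun Z _ => h𝒳 Z)]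

end Ursell

/-! ## Part E. p. 18 — the sum over the large-field sets `P` ((2.31)) and the cube count behind it -/

section PSum

/-- p. 18, verbatim: *"The definition of Z₀ yields |P| ≧ ½M⁻⁴|Z₀∖Y₀|, because one bond in P may connect two cubes in
Z₀∖Y₀."* — the counting fact used: if every cube of `W` (= the cubes of Z₀∖Y₀) meets some bond of `P` (`W ⊆ ⋃_{b∈P}
touch b`, Z₀ being the smallest domain containing Y₀ and P) and a bond meets at most two cubes, then `|W| ≤ 2|P|`.
(The cell transcript notes that this needs Z₀ := Y₀ ∪ {cubes meeting P}, possibly disconnected, as p. 18 itself says: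
*"In general the set Z₀ is a union of connected components"*.) [cite: Balaban1988RG2Cluster, p.18 (before (2.31))] -/
theorem card_le_two_mul_card_of_cover {α β : Type*} [DecidableEq α] (W : Finset α) (P : Finset β)
    (touch : β → Finset α) (h2 : ∀ b ∈ P, (touch b).card ≤ 2) (hcov : W ⊆ P.biUnion touch) :
    W.card ≤ 2 * P.card := by
  calc W.card ≤ (P.biUnion touch).card := Finset.card_le_card hcov
    _ ≤ ∑ b ∈ P, (touch b).card := Finset.card_biUnion_le
    _ ≤ ∑ b ∈ P, 2 := Finset.sum_le_sum h2
    _ = 2 * P.card := by rw [Finset.sum_const, smul_eq_mul, mul_comm]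

/-- **(2.31) p. 18** certified, verbatim: *"We decompose the exponential factor into a product of five equal factors.
Four of them are bounded using the above inequality, the fifth is used to bound the sum over P, with a fixed Y₀. We have
Σ_P exp(−(1/20)γ₂(ε₁²/g_k²)M⁻⁴|Z₀∖Y₀|) exp(−(1/10)γ₂(ε₁²/g_k²)|P|)
  ≦ exp{−M⁻⁴|Z₀∖Y₀|[(1/20)γ₂ε₁²/g_k² − 4M⁴ exp(−(1/10)γ₂ε₁²/g_k²)]} ≦ 1
for g_k², i.e. γ² sufficiently small, depending on M and κ."* — with `a = γ₂ε₁²/g_k² ≥ 0`, `N = M⁻⁴|Z₀∖Y₀| ≥ 0`, the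
sets `P` ranging over the subsets of a set `S` of bonds with `|S| ≤ M4·N` (print: `M4 = 4M⁴`, four bonds per site):
the sum is `e^{−(a/20)N}(1 + e^{−a/10})^{|S|} ≤ exp(−N[(a/20) − M4 e^{−a/10}])`, and this is `≤ 1` once
`M4 e^{−a/10} ≤ a/20` (the printed smallness of g_k). [cite: Balaban1988RG2Cluster, (2.31) p.18] -/
theorem sum_P_bound_231 {α : Type*} [DecidableEq α] (S : Finset α) (a N M4 : ℝ)
    (hS : (S.card : ℝ) ≤ M4 * N) :
    ∑ P ∈ S.powerset, Real.exp (-(a / 20 * N)) * Real.exp (-(a / 10 * P.card))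
      ≤ Real.exp (-(N * (a / 20 - M4 * Real.exp (-(a / 10))))) := by
  set t : ℝ := Real.exp (-(a / 10)) with ht
  have ht0 : 0 ≤ t := (Real.exp_pos _).le
  have hterm : ∀ P ∈ S.powerset, Real.exp (-(a / 20 * N)) * Real.exp (-(a / 10 * P.card))
      = Real.exp (-(a / 20 * N)) * t ^ P.card := by
    intro P _
    rw [ht, ← Real.exp_nat_mul]
    congr 2
    ring
  rw [Finset.sum_congr rfl hterm, ← Finset.mul_sum]
  have hsum : ∑ P ∈ S.powerset, t ^ P.card = (t + 1) ^ S.card := by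
    rw [← Finset.sum_pow_mul_eq_add_pow t 1 S]
    exact Finset.sum_congr rfl fun P _ => by rw [one_pow, mul_one]
  have hpow : (t + 1) ^ S.card ≤ Real.exp (M4 * N * t) := by
    calc (t + 1) ^ S.card ≤ Real.exp t ^ S.card := pow_le_pow_left₀ (by positivity) (Real.add_one_le_exp t) _
      _ = Real.exp ((S.card : ℝ) * t) := by rw [← Real.exp_nat_mul]
      _ ≤ Real.exp (M4 * N * t) := Real.exp_le_exp.2 (mul_le_mul_of_nonneg_right hS ht0)
  calc Real.exp (-(a / 20 * N)) * ∑ P ∈ S.powerset, t ^ P.card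
      ≤ Real.exp (-(a / 20 * N)) * Real.exp (M4 * N * t) := by
        rw [hsum]; exact mul_le_mul_of_nonneg_left hpow (Real.exp_pos _).le
    _ = Real.exp (-(N * (a / 20 - M4 * t))) := by rw [← Real.exp_add]; ring_nf

/-- The last step of (2.31): `exp(−N[(a/20) − M4 e^{−a/10}]) ≤ 1` for `N ≥ 0` under the printed smallness
`M4 e^{−a/10} ≤ a/20` (*"for g_k², i.e. γ² sufficiently small, depending on M and κ"*). [cite: Balaban1988RG2Cluster, (2.31) p.18] -/
theorem bound_231_le_one (a N M4 : ℝ) (hN : 0 ≤ N) (hsmall : M4 * Real.exp (-(a / 10)) ≤ a / 20) :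
    Real.exp (-(N * (a / 20 - M4 * Real.exp (-(a / 10))))) ≤ 1 := by
  rw [Real.exp_le_one_iff]
  have : 0 ≤ N * (a / 20 - M4 * Real.exp (-(a / 10))) := mul_nonneg hN (by linarith)
  linarith

end PSum

/-! ## Part F. (1.9) p. 4 with the printed integrals: `Π_{Δ∈σ} ∫₀¹ ds(Δ) ∂/∂s(Δ)` for functions with continuous
mixed partial derivatives along the parameter axes (the paper's functions are analytic in `s`, p. 5) -/

section Analytic

variable {ι : Type*} [DecidableEq ι] {E : Type*} [NormedAddCommGroup E] [NormedSpace ℝ E] [CompleteSpace E]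

/-- The printed operator of (1.9), `Π_{Δ∈l} ∫₀¹ ds(Δ) ∂/∂s(Δ)` applied in the order of the list `l`, the mixed
partial derivatives being supplied as a family `Fam` (`Fam [] = E(…(s))`, `Fam (Δ :: l′)` = the partials along `l′`
of `∂E/∂s(Δ)`; cf. `HasLinePartials`). [cite: Balaban1988RG2Cluster, (1.9) p.4] -/
def Top : List ι → (List ι → (ι → ℝ) → E) → (ι → ℝ) → E
  | [], Fam, s => Fam [] s
  | Δ :: l, Fam, s => ∫ x in (0 : ℝ)..1, Top l (fun l' => Fam (Δ :: l')) (Function.update s Δ x)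

/-- The regularity actually used by (1.9): along every parameter axis `s(Δ)` and at every order, `Fam l` has the
derivative `Fam (l ++ [Δ])` (so `Fam l` = the mixed partial `∂^{l}` of `Fam []`, taken in the order of `l`).  The
paper's functions are analytic in `s` on the polydisc `|s(Δ)| ≤ e^{κ₁}` (p. 5), in particular of this class.
(Existing device-form carrier of the locus: `B13GaugeDevices.Inv.paramOp`, see `corner`.)
[cite: Balaban1988RG2Cluster, (1.9) p.4 and p.5] -/
def HasLinePartials (Fam : List ι → (ι → ℝ) → E) : Prop :=
  ∀ (l : List ι) (Δ : ι) (p : ι → ℝ) (y : ℝ),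
    HasDerivAt (fun y => Fam l (Function.update p Δ y)) (Fam (l ++ [Δ]) (Function.update p Δ y)) y

omit [CompleteSpace E] in
/-- The family of partials of `∂E/∂s(Δ)` inherits the regularity (plumbing).
[cite: Balaban1988RG2Cluster, (1.9) p.4] (elementary API for (1.9)) -/
private theorem HasLinePartials.shift {Fam : List ι → (ι → ℝ) → E} (h : HasLinePartials Fam) (Δ : ι) :
    HasLinePartials (fun l' => Fam (Δ :: l')) :=
  fun l Δ' p y => by simpa [List.cons_append] using h (Δ :: l) Δ' p y

omit [CompleteSpace E] in
/-- Differentiable along an axis, hence continuous along it (plumbing).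
[cite: Balaban1988RG2Cluster, (1.9) p.4] (elementary API for (1.9)) -/
private theorem HasLinePartials.continuous_line {Fam : List ι → (ι → ℝ) → E} (h : HasLinePartials Fam)
    (l : List ι) (Δ : ι) (p : ι → ℝ) : Continuous (fun y => Fam l (Function.update p Δ y)) :=
  continuous_iff_continuousAt.2 fun y => (h l Δ p y).continuousAt

omit [CompleteSpace E] in
/-- `Dop` with real scalars (plumbing for the calculus lemmas).
[cite: Balaban1988RG2Cluster, (1.9) p.4] (elementary API for (1.9)) -/
private theorem Dop_eq_sum_real_smul (σ : Finset ι) (G : (ι → ℝ) → E) (s : ι → ℝ) :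
    Dop σ G s = ∑ τ ∈ σ.powerset, ((-1 : ℝ) ^ (σ \ τ).card) • G (corner σ τ s) := by
  simp only [Dop]
  refine Finset.sum_congr rfl fun τ _ => ?_
  rw [← Int.cast_smul_eq_zsmul ℝ, Int.cast_pow, Int.cast_neg, Int.cast_one]

omit [CompleteSpace E] in
/-- Differentiating the iterated difference `D_σ E` along a fresh axis `s(Δ)`, `Δ ∉ σ`, gives `D_σ (∂E/∂s(Δ))`
(plumbing: finite sums and the chain of corners commute with the update at `Δ`).
[cite: Balaban1988RG2Cluster, (1.9) p.4] (elementary API for (1.9)) -/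
private theorem hasDerivAt_Dop_line {Fam : List ι → (ι → ℝ) → E} (h : HasLinePartials Fam) {σ : Finset ι}
    {Δ : ι} (hΔ : Δ ∉ σ) (s : ι → ℝ) (x : ℝ) :
    HasDerivAt (fun y => Dop σ (Fam []) (Function.update s Δ y))
      (Dop σ (Fam [Δ]) (Function.update s Δ x)) x := by
  have key : ∀ (G : (ι → ℝ) → E) (y : ℝ), Dop σ G (Function.update s Δ y)
      = ∑ τ ∈ σ.powerset, ((-1 : ℝ) ^ (σ \ τ).card) • G (Function.update (corner σ τ s) Δ y) := by
    intro G y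
    rw [Dop_eq_sum_real_smul]
    exact Finset.sum_congr rfl fun τ _ => by rw [corner_update hΔ]
  simp_rw [key]
  exact HasDerivAt.fun_sum fun τ _ => by
    simpa using (h [] Δ (corner σ τ s) x).fun_const_smul ((-1 : ℝ) ^ (σ \ τ).card)

/-- **The printed form of (1.9) equals the iterated difference**: for a function with the regularity
`HasLinePartials`, `(Π_{Δ∈l} ∫₀¹ ds(Δ) ∂/∂s(Δ)) E = D_{l} E` for every list `l` of distinct cubes — by induction on
`l`, one fundamental theorem of calculus per cube (p. 4: *"we apply the fundamental theorem of calculus"*); in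
particular the value does not depend on the order in which the cubes are taken. [cite: Balaban1988RG2Cluster, (1.9) p.4] -/
theorem Top_eq_Dop {Fam : List ι → (ι → ℝ) → E} (h : HasLinePartials Fam) :
    ∀ (l : List ι), l.Nodup → ∀ s, Top l Fam s = Dop l.toFinset (Fam []) s := by
  intro l
  induction l generalizing Fam with
  | nil => intro _ s; simp [Top, Dop_empty]
  | cons Δ l ih =>
    intro hnd s
    obtain ⟨hΔ, hl⟩ := List.nodup_cons.1 hnd
    have hΔ' : Δ ∉ l.toFinset := by simpa using hΔ
    simp only [Top, List.toFinset_cons]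
    have hIH : ∀ x, Top l (fun l' => Fam (Δ :: l')) (Function.update s Δ x)
        = Dop l.toFinset (Fam [Δ]) (Function.update s Δ x) :=
      fun x => ih (HasLinePartials.shift h Δ) hl _
    simp_rw [hIH]
    have hder : ∀ x ∈ Set.uIcc (0 : ℝ) 1, HasDerivAt (fun y => Dop l.toFinset (Fam []) (Function.update s Δ y))
        (Dop l.toFinset (Fam [Δ]) (Function.update s Δ x)) x :=
      fun x _ => hasDerivAt_Dop_line h hΔ' s x
    have hcont : Continuous fun x => Dop l.toFinset (Fam [Δ]) (Function.update s Δ x) := by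
      have hrw : ∀ x, Dop l.toFinset (Fam [Δ]) (Function.update s Δ x)
          = ∑ τ ∈ l.toFinset.powerset, ((-1 : ℝ) ^ (l.toFinset \ τ).card) •
              Fam [Δ] (Function.update (corner l.toFinset τ s) Δ x) := by
        intro x
        rw [Dop_eq_sum_real_smul]
        exact Finset.sum_congr rfl fun τ _ => by rw [corner_update hΔ']
      simp_rw [hrw]
      exact continuous_finsetSum _ fun τ _ => (HasLinePartials.continuous_line h [Δ] Δ _).const_smul _
    rw [intervalIntegral.integral_eq_sub_of_hasDerivAt hder (hcont.intervalIntegrable 0 1), Dop_insert hΔ']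
    rfl

/-- **(1.9) p. 4 with the printed integrals.**  For every function `E(s)` of the parameters with continuous mixed
partials along the axes to all orders (`HasLinePartials Fam`, `Fam [] = E`):
`Σ_{σ⊆σ₀} (Π_{Δ∈σ} ∫₀¹ ds(Δ) ∂/∂s(Δ)) E |_{s(σ₀∖σ)=0} = E|_{s(σ₀)=1}`, verbatim the display (1.9) (whose left side
`E(□₀, (tζ̃_□ + t_□ζ_□)H_k(B′))` is the value at `s = 1` by (1.8)); the products taken in any order (`Finset.toList`).
[cite: Balaban1988RG2Cluster, (1.9) p.4] -/
theorem decoupling_19_integral {Fam : List ι → (ι → ℝ) → E} (h : HasLinePartials Fam) (σ₀ : Finset ι)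
    (s : ι → ℝ) :
    ∑ σ ∈ σ₀.powerset, Top σ.toList Fam (corner σ₀ ∅ s) = Fam [] (corner σ₀ σ₀ s) := by
  rw [← decoupling_19 σ₀ (Fam []) s]
  refine Finset.sum_congr rfl fun σ _ => ?_
  rw [Top_eq_Dop h σ.toList (Finset.nodup_toList σ), Finset.toList_toFinset]

end Analytic

/-! ## Part G. (1.10) p. 4 (v6, append-only): connectedness relative to □̃⁴, the component Y₀, and the reduction of
the sum (1.9) to the connected domains Y₀ ∋ □̃⁴ -/

section Component

variable {ι : Type*} (W : ι → ι → Prop) (B : ι → Prop)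

/-- p. 4 [PDF 4], the chains: *"a sequence Δ, Δ₁, …, Δ_n, Δ′ of cubes contained in Y and such, that boundaries of two
successive terms in the sequence have a common d − 1-dimensional wall"* — the reflexive-transitive closure, INSIDE the
family `σ`, of the wall-adjacency `W` (abstract: `W Δ Δ′` = "the boundaries of Δ and Δ′ have a common (d−1)-dimensional
wall"; case 1 of the printed definition = the sibling `B13Factor210.WallConnected` / `B13ScaleTransfer.Linked` on the
concrete cube carrier). [cite: Balaban1988RG2Cluster, p.4 (after (1.9))] -/
def Linked (σ : Finset ι) : ι → ι → Prop :=
  Relation.ReflTransGen fun a b : ι => a ∈ σ ∧ b ∈ σ ∧ W a b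

open Classical in
/-- p. 4 [PDF 4], verbatim: *"We denote by Y₀ the connected component of the domain Y(σ) containing the cube □̃⁴."* —
`compY0 W B σ` = the cubes of σ lying in Y₀, i.e. those chained inside σ to a cube meeting □̃⁴ along a (d−1)-dimensional
wall (`B Δ′`); Y₀ = □̃⁴ ∪ ⋃ compY0. [cite: Balaban1988RG2Cluster, p.4 (after (1.9))] -/
def compY0 (σ : Finset ι) : Finset ι :=
  σ.filter fun Δ => ∃ Δ' ∈ σ, B Δ' ∧ Linked W σ Δ Δ'

/-- p. 4 [PDF 4], the definition, case 2, verbatim: *"In the second case [Y contains the cube □̃⁴] Y is connected if and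
only if for any cube Δ ⊂ Y there exists a sequence having the above property and connecting Δ with □̃⁴, i.e. the last
term in the sequence intersects □̃⁴ along a d − 1-dimensional wall."* — for Y = Y(σ) = □̃⁴ ∪ ⋃_{Δ∈σ}Δ.
[cite: Balaban1988RG2Cluster, p.4 (after (1.9))] -/
def RelConnected (σ : Finset ι) : Prop :=
  ∀ Δ ∈ σ, ∃ Δ' ∈ σ, B Δ' ∧ Linked W σ Δ Δ'

/-- `Y₀∖□̃⁴ ⊆ ⋃σ`. [cite: Balaban1988RG2Cluster, p.4 (after (1.9))] -/
theorem compY0_subset (σ : Finset ι) : compY0 W B σ ⊆ σ := by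
  classical
  unfold compY0
  exact Finset.filter_subset _ _

/-- Membership in Y₀. [cite: Balaban1988RG2Cluster, p.4 (after (1.9))] -/
theorem mem_compY0 {σ : Finset ι} {Δ : ι} :
    Δ ∈ compY0 W B σ ↔ Δ ∈ σ ∧ ∃ Δ' ∈ σ, B Δ' ∧ Linked W σ Δ Δ' := by
  classical
  unfold compY0
  rw [Finset.mem_filter]

/-- Y(σ) is connected (case 2) iff Y₀ is all of Y(σ). [cite: Balaban1988RG2Cluster, p.4 (after (1.9))] -/
theorem relConnected_iff_compY0_eq (σ : Finset ι) : RelConnected W B σ ↔ compY0 W B σ = σ := by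
  constructor
  · intro h
    refine Finset.Subset.antisymm (compY0_subset W B σ) fun Δ hΔ => ?_
    exact (mem_compY0 W B).2 ⟨hΔ, h Δ hΔ⟩
  · intro h Δ hΔ
    rw [← h] at hΔ
    exact ((mem_compY0 W B).1 hΔ).2

/-- If Y(σ) is NOT connected, some cube of σ lies outside Y₀ (*"If there are other components …"*).
[cite: Balaban1988RG2Cluster, p.4 (after (1.9))] -/
theorem exists_not_mem_compY0 (σ : Finset ι) (h : ¬ RelConnected W B σ) : ∃ Δ ∈ σ, Δ ∉ compY0 W B σ := by
  by_contra hc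
  push Not at hc
  exact h fun Δ hΔ => ((mem_compY0 W B).1 (hc Δ hΔ)).2

/-- `Y(∅) = □̃⁴` is connected. [cite: Balaban1988RG2Cluster, p.4 (after (1.9))] -/
theorem relConnected_empty : RelConnected W B (∅ : Finset ι) := fun Δ hΔ => absurd hΔ (Finset.notMem_empty Δ)

/-- A chain inside σ ending at a cube Δ′ meeting □̃⁴ runs inside Y₀ (every cube on it is itself chained to Δ′).
[cite: Balaban1988RG2Cluster, p.4 (after (1.9))] -/
theorem linked_compY0 {σ : Finset ι} {Δ Δ' : ι} (hΔ' : Δ' ∈ σ) (hB : B Δ') (h : Linked W σ Δ Δ') :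
    Linked W (compY0 W B σ) Δ Δ' := by
  unfold Linked at h ⊢
  induction h using Relation.ReflTransGen.head_induction_on with
  | refl => exact Relation.ReflTransGen.refl
  | head hac hcb ih =>
    obtain ⟨ha, hc, hw⟩ := hac
    refine Relation.ReflTransGen.head ⟨?_, ?_, hw⟩ ih
    · exact (mem_compY0 W B).2 ⟨ha, Δ', hΔ', hB, Relation.ReflTransGen.head ⟨ha, hc, hw⟩ hcb⟩
    · exact (mem_compY0 W B).2 ⟨hc, Δ', hΔ', hB, hcb⟩

/-- **Y₀ is a connected domain containing □̃⁴** (case 2 of the definition holds for Y₀ = □̃⁴ ∪ ⋃ compY0).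
[cite: Balaban1988RG2Cluster, p.4 (after (1.9))] -/
theorem relConnected_compY0 (σ : Finset ι) : RelConnected W B (compY0 W B σ) := by
  intro Δ hΔ
  obtain ⟨-, Δ', hΔ', hB, hl⟩ := (mem_compY0 W B).1 hΔ
  exact ⟨Δ', (mem_compY0 W B).2 ⟨hΔ', Δ', hΔ', hB, Relation.ReflTransGen.refl⟩, hB, linked_compY0 W B hΔ' hB hl⟩

end Component

section Reduction

variable {ι : Type*} [DecidableEq ι] {E : Type*} [AddCommGroup E]

/-- **The mechanism of (1.10), localized** (p. 4: *"If there are other components, then the derivatives with respect to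
s restricted to these components render the term equal to 0"*): the σ-term `D_σ G` VANISHES AT THE POINT `s₀` as soon as
`G` does not depend on the parameter `s(Δ)`, for one `Δ ∈ σ`, on the parameter points agreeing with `s₀` off `σ` —
which is all the p. 4 claim provides (independence for *"s satisfying s(σᶜ) = 0"*), unlike the global `Dop_eq_zero_of_indep`.
[cite: Balaban1988RG2Cluster, (1.10) p.4] -/
theorem Dop_eq_zero_of_indep_at {σ : Finset ι} {Δ : ι} (hΔ : Δ ∈ σ) (G : (ι → ℝ) → E) (s₀ : ι → ℝ)
    (hG : ∀ t : ι → ℝ, (∀ i, i ∉ σ → t i = s₀ i) →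
      ∀ a : ℝ, G (Function.update t Δ a) = G (Function.update t Δ 0)) :
    Dop σ G s₀ = 0 := by
  have hσ : σ = insert Δ (σ.erase Δ) := (Finset.insert_erase hΔ).symm
  have hΔ' : Δ ∉ σ.erase Δ := Finset.notMem_erase Δ σ
  have ht : ∀ τ : Finset ι, ∀ i, i ∉ σ → corner (σ.erase Δ) τ s₀ i = s₀ i := by
    intro τ i hi
    have hi' : i ∉ σ.erase Δ := fun h => hi (Finset.mem_of_mem_erase h)
    simp [corner, hi']
  rw [hσ, Dop_insert hΔ']
  simp only [delta, Dop]
  rw [← Finset.sum_sub_distrib]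
  refine Finset.sum_eq_zero fun τ _ => ?_
  rw [corner_update hΔ', corner_update hΔ', hG _ (ht τ) 1, sub_self]

/-- **(1.10) p. 4 [PDF 4].**  Verbatim: *"As a consequence of these properties we obtain that the term in the sum on the
right-hand side of (1.9), corresponding to the set σ, depends on propagators and function B, s restricted to the
component Y₀, the component of Y(σ) containing □̃⁴. If there are other components, then the derivatives with respect to
s restricted to these components render the term equal to 0. This simplifies the sum in (1.9). We can write it as a
sum over connected domains Y₀ containing □̃⁴, with parameters s = 0 on Y₀ᶜ. We denote s by s(Y₀), hence we have*
`E(□₀,(tζ̃_□+t_□ζ_□)H_k(B′)) = Σ_{Y₀} Π_{Δ⊂Y₀∖□̃⁴} ∫₀¹ ds(Δ) ∂/∂s(Δ) E(□₀,(tζ̃_□+t_□ζ_□)H_k(H(s(Y₀)),G̃(s(Y₀)),(H₀B′)(s(Y₀))))`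
(1.10)" — PROVED from (1.9) (`decoupling_19`) for every function `G` of the parameters satisfying the p. 4 SUPPORT
CLAIM (hypothesis `hsupp`, by assertion in print): for every σ ⊆ σ₀ and every cube Δ ∈ σ outside the component Y₀ of
Y(σ), `G` does not depend on `s(Δ)` at the parameter points vanishing on σ₀∖σ.  Conclusion: `E|_{s(σ₀)=1}` = the sum,
over the σ ⊆ σ₀ with Y(σ) connected (= the connected domains Y₀ = □̃⁴ ∪ ⋃σ ∋ □̃⁴), of the σ-terms of (1.9) at s = 0 off σ
(= s(Y₀)), in the iterated-difference form `D_σ` (`= Π_{Δ∈σ}∫₀¹ds(Δ)∂/∂s(Δ)`, `Top_eq_Dop`; integral form: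
`decoupling_110_integral`). [cite: Balaban1988RG2Cluster, (1.10) p.4] -/
theorem decoupling_110 (W : ι → ι → Prop) (B : ι → Prop) [DecidablePred (RelConnected W B)]
    (σ₀ : Finset ι) (G : (ι → ℝ) → E) (s : ι → ℝ)
    (hsupp : ∀ σ, σ ⊆ σ₀ → ∀ Δ ∈ σ, Δ ∉ compY0 W B σ →
      ∀ t : ι → ℝ, (∀ i, i ∉ σ → t i = corner σ₀ ∅ s i) →
        ∀ a : ℝ, G (Function.update t Δ a) = G (Function.update t Δ 0)) :
    G (corner σ₀ σ₀ s) =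
      ∑ σ ∈ σ₀.powerset.filter (fun σ => RelConnected W B σ), Dop σ G (corner σ₀ ∅ s) := by
  have hzero : ∑ σ ∈ σ₀.powerset.filter (fun σ => ¬ RelConnected W B σ), Dop σ G (corner σ₀ ∅ s) = 0 := by
    refine Finset.sum_eq_zero fun σ hσ => ?_
    obtain ⟨hσ₀, hnc⟩ := Finset.mem_filter.1 hσ
    obtain ⟨Δ, hΔ, hΔc⟩ := exists_not_mem_compY0 W B σ hnc
    exact Dop_eq_zero_of_indep_at hΔ G _ (hsupp σ (Finset.mem_powerset.1 hσ₀) Δ hΔ hΔc)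
  rw [← decoupling_19 σ₀ G s,
    ← Finset.sum_filter_add_sum_filter_not σ₀.powerset (fun σ => RelConnected W B σ), hzero, add_zero]

end Reduction

section ReductionIntegral

variable {ι : Type*} [DecidableEq ι] {E : Type*} [NormedAddCommGroup E] [NormedSpace ℝ E] [CompleteSpace E]

/-- **(1.10) p. 4 with the printed integrals** `Π_{Δ⊂Y₀∖□̃⁴} ∫₀¹ ds(Δ) ∂/∂s(Δ)`: for a function with the regularity
`HasLinePartials` (the paper's functions are analytic in s, p. 5) satisfying the p. 4 support claim, `E|_{s(σ₀)=1}` =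
Σ over the connected domains Y₀ = □̃⁴ ∪ ⋃σ of `(Π_{Δ∈σ} ∫₀¹ ds(Δ) ∂/∂s(Δ)) E` at `s(Y₀)` (products in any order).
[cite: Balaban1988RG2Cluster, (1.10) p.4] -/
theorem decoupling_110_integral (W : ι → ι → Prop) (B : ι → Prop) [DecidablePred (RelConnected W B)]
    {Fam : List ι → (ι → ℝ) → E} (h : HasLinePartials Fam) (σ₀ : Finset ι) (s : ι → ℝ)
    (hsupp : ∀ σ, σ ⊆ σ₀ → ∀ Δ ∈ σ, Δ ∉ compY0 W B σ →
      ∀ t : ι → ℝ, (∀ i, i ∉ σ → t i = corner σ₀ ∅ s i) →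
        ∀ a : ℝ, Fam [] (Function.update t Δ a) = Fam [] (Function.update t Δ 0)) :
    Fam [] (corner σ₀ σ₀ s) =
      ∑ σ ∈ σ₀.powerset.filter (fun σ => RelConnected W B σ), Top σ.toList Fam (corner σ₀ ∅ s) := by
  rw [decoupling_110 W B σ₀ (Fam []) s hsupp]
  refine Finset.sum_congr rfl fun σ _ => ?_
  rw [Top_eq_Dop h σ.toList (Finset.nodup_toList σ), Finset.toList_toFinset]

end ReductionIntegral

end Literature.MathematicalPhysics.QuantumFieldTheory.Balaban1983to89.B13MayerDecoupling
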